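import Summits.BirchSwinnertonDyer.BirchSwinnertonDyer.Theorems.GenusKolyvaginAtTwoK4NegOfWallRowsU2HalvingBit
import Summits.BirchSwinnertonDyer.BirchSwinnertonDyer.Theorems.GenusKolyvaginAtTwoK4NegPhantomCellDescentBit
import Summits.BirchSwinnertonDyer.BirchSwinnertonDyer.Theorems.GenusKolyvaginAtTwoK4NegPhantomFramePrimeFrobenius
import Summits.BirchSwinnertonDyer.BirchSwinnertonDyer.Theorems.GenusKolyvaginAtTwoOffCutResidualAtTwoRLw2PhantomExclusionRatSelmer
import HarnessLib

/-!
# Route `GenusKolyvaginAtTwo`, crux K₄⁻ `K4Neg` (stmt-BirchSwinnertonDyer-31526) — K4Neg AT A FRAME ⟸ WALL row 1 + U₂ + Q2 + PRINT under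
# EACH of the four frame bits: (NPh_K) · «no level-4 phantom is a rational 2-Selmer class» · the (α) Galois datum · `4 ∤ a_{ℓ₀}(E)`

LEAD seat `bsd-line-gk2-p1` g29, `--supports stmt-BirchSwinnertonDyer-31526 --as helper`.  THEOREMS ONLY; no `sorry`; standard axioms.
**BSD is NOT proved here; K4Neg is NOT proved; nothing is closed.**  Every theorem below is CONDITIONAL on OPEN route items (the four WALL
rows of `ByReductionTypeAtTwo` 19095–19098, U₂ `MinimalTwinBSDTwo` 22985, Q2 `KolyvaginRelationAtTwo` 24880) and the PRINT items, all BY NAME.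

The LEAD road of g28 (`kFourNeg_conclusion_of_wallRows_U2_of_halvingBit`, p788928) concludes K4Neg's conclusion at ANY frame from the route
items and ONE bit `hHalf` («a `K`-point halvable by a `Γ_{K(E[4])}`-fixed point is halvable in `E(K)`»).  This file discharges `hHalf` / the older
`hDesc` from each of the currencies the cell produced since, so that the pen and the supply can plug whichever they hold:

* §0 `isOfFinAddOrder_toGeomPoints_of_finite` — `E(ℚ)` finite ⟹ every rational point is torsion read in `E(ℚ̄)` (the form gk2-p3's plug consumes).
* §1 `halvingBit_of_nonPhantom` — **(NPh_K) ⟹ hHalf** (pure Kummer theory: the level-`4` Kummer class of `2R` with root `Q` dies on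
  `Γ_{K(E[4])}` and is Selmer, so it vanishes; `E(K)[2] = 0`).
* §2 `kFourNeg_conclusion_of_wallRows_U2_of_nonPhantom` — K4Neg at a frame ⟸ WALL + U₂ + Q2 + PRINT + (NPh_K) (all-places form), ANY
  reduction at `2`, on or off the cut (supersedes LINE 34 v1.2's off-cut road).
* §3 `kFourNeg_conclusion_of_wallRows_U2_of_forall_phantom_notMem_selmerGroup` — the same from «every non-zero `x ∈ H¹(ℚ, E[2])` dying on
  `Γ_{ℚ(E[4])}` lies OUTSIDE `Sel₂(E/ℚ)`» (the bit-TRUE curves), via the LEAD g26 iff `nonPhantom_pow_iff_forall_notMem_selmerGroup_rat`.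
* §4 `kFourNeg_conclusion_of_wallRows_U2_of_alive` — the same from the (α) GALOIS DATUM of gk2-p3 g34 («a non-zero `ξ` dying on `Γ_{ℚ(E[4])}`
  with `[ξ, F·F] ≠ 0` for an arithmetic Frobenius `F` over `ℓ₀ = −d_K`, `F·F ∈ Γ_{ℚ(E[2])}`»): `hDesc` by `PhantomDescentBit.hDesc_of_phantom_alive`
  (p789560), «`E(ℚ)` torsion» from GZK at `r_an = 0`, then g28's `kFourNeg_conclusion_of_bsdp_pair_of_heegnerDescent` (p787847).
* §5 ★ `kFourNeg_conclusion_of_wallRows_U2_of_not_four_dvd_frobeniusTrace` — **K4Neg at every prime Heegner frame with `4 ∤ a_{ℓ₀}(E)` ⟸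
  WALL + U₂ + Q2 + PRINT** (gk2-p4 g34's prime-frame trace bit `TraceBit.h1Eval_frob_mul_frob_eq_zero_iff_four_dvd_of_prime_frame`, p790039,
  turns `4 ∤ a_{ℓ₀}` into the (α) datum for the Lawson–Wuthrich class).  This is the by-name closer of the RESTATED item «K4Neg with the extra
  binder `¬ 4 ∣ W.frobeniusTrace ℓ₀`» recommended to the planner (LEAD-BRIEF-g28 §4, director (657)(b)); the (β)-frames `4 ∣ a_{ℓ₀}` remain.

References: [LawsonWuthrich2016] §3, §7.1; [McCallumLMS1991] §5 Thm. 5.4; [Kolyvagin1989Izv] Thm. B₂; [GrossLMS1991] §9 Prop. 9.6;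
[MazurRubin2010] Cor. 3.4 (i); [SilvermanAEC2009] VIII.§2, X.4.
-/

set_option autoImplicit false
-- the Theorems namespace of this sub repeats the summit name by design (D-0017 nested layout)
set_option linter.dupNamespace false

noncomputable section

open scoped Classical

namespace Summit.BirchSwinnertonDyer.BirchSwinnertonDyer.Theorems.GenusExact.PlusDescent

open WeierstrassCurve NumberField IsDedekindDomain Field Literature.NumberTheory.EllipticCurves
  Literature.NumberTheory.GaloisRepresentations Literature.NumberTheory.EllipticCurves.ModularForms
  Literature.NumberTheory.EllipticCurves.RingClassField Rat.HeightOneSpectrum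
open Summit.BirchSwinnertonDyer.BirchSwinnertonDyer.Theses.GenusKolyvaginAtTwo
  (KolyvaginRelationAtTwo GrossZagierAllLevels MultPublishedInputsAtTwo EntireLFunctionRat MilneAnyModel MinimalTwinBSDTwo)
open Summit.BirchSwinnertonDyer.BirchSwinnertonDyer.Theses.ByReductionTypeAtTwo
  (GoodOrdinaryRankZeroAtTwo MultiplicativeRankZeroAtTwo SupersingularRankZeroAtTwo AdditiveRankZeroAtTwo)
open Summit.BirchSwinnertonDyer.BirchSwinnertonDyer.Theorems.GenusExact

/-! ## §0 «`E(ℚ)` finite ⟹ every rational point is torsion, read in `E(ℚ̄)`» -/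

/-- **`E(ℚ)` finite ⟹ `ι_* s` has finite order in `E(ℚ̄)` for every `s ∈ E(ℚ)`** (the instance-robust reading used by gk2-p3's
`PhantomDescentBit.forall_fixed_odd_torsion_of_rank_zero`).  `WeierstrassCurve.toGeomPoints` (Literature `SelmerCorankProofs`) is stated over a
general field with classical decidability of equality on the base field; the `letI` makes the group law on `E(ℚ)` elaborate the same way here.
[cite: SilvermanAEC2009, VIII.§1] -/
theorem isOfFinAddOrder_toGeomPoints_of_finite (W : WeierstrassCurve ℚ) [W.IsElliptic] [Finite W.toAffine.Point]
    (s : W.toAffine.Point) : IsOfFinAddOrder (WeierstrassCurve.toGeomPoints W s) := by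
  letI instD : DecidableEq ℚ := fun a b => Classical.propDecidable (a = b)
  exact (WeierstrassCurve.toGeomPoints W).isOfFinAddOrder (isOfFinAddOrder_of_finite s)

/-! ## §1 (NPh_K) ⟹ the halving bit -/

/-- **(NPh_K) ⟹ hHalf.**  `E/ℚ` elliptic with `ρ_{E,2^n}` onto for all `n`, `K` imaginary quadratic.  If every class of `H¹(K, E[2^L])`
(`L ≥ 1`) dying on `Γ_{K(E[2^L])}` and lying in the Selmer local condition at every finite place is `0` («no locally-trivial phantom
classes», the all-places form of (NPh_K)), then every `K`-rational `R` with a half `Q ∈ E(K̄)` fixed by `Γ_{K(E[4])}` is halvable in `E(K)`: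
the level-`4` Kummer class of `2R` is the class of `σ ↦ σQ − Q` (root `Q`, `4Q = 2R`), it dies on `Γ_{K(E[4])}` and is Selmer, hence `0`;
so `2R = 4R″` and `R = 2R″` (`E(K)[2] = 0`). [cite: SilvermanAEC2009, VIII.§2, Thm. X.4.2 (a)] [cite: LawsonWuthrich2016, §7.1] -/
theorem halvingBit_of_nonPhantom
    (W : WeierstrassCurve ℚ) [W.IsElliptic] (K : Type) [Field K] [NumberField K] (hIQ : IsImaginaryQuadratic K)
    (hρ : ∀ n : ℕ, 0 < n → W.HasSurjectiveModNGaloisRep ((2 : ℤ) ^ n))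
    (hNPh : ∀ (L : ℕ), 1 ≤ L → ∀ z : galH1Torsion (W.baseChange K) ((2 ^ L : ℕ) : ℤ),
      (∀ ρ' ∈ torsionFixing (W.baseChange K) ((2 ^ L : ℕ) : ℤ), h1Eval (W.baseChange K) ((2 ^ L : ℕ) : ℤ) z ρ' = 0) →
      (∀ w : HeightOneSpectrum (𝓞 K), z ∈ selmerLocalKer (W.baseChange K) (w.adicCompletion K) ((2 ^ L : ℕ) : ℤ)) → z = 0) :
    ∀ (R : (W.baseChange K).toAffine.Point) (Q : geomPoints (W.baseChange K)),
      (∀ ρ ∈ torsionFixing (W.baseChange K) (4 : ℤ), ρ • Q = Q) → (2 : ℤ) • Q = toGeomPoints (W.baseChange K) R →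
      ∃ R' : (W.baseChange K).toAffine.Point, (2 : ℤ) • R' = R := by
  haveI hell : (W.baseChange K).IsElliptic := inferInstanceAs ((W.map (algebraMap ℚ K)).IsElliptic)
  intro R Q hQfix hQ
  have h2 : Module.finrank ℚ K = 2 := hIQ.1
  have hs2 : W.HasSurjectiveModNGaloisRep 2 := by simpa using hρ 1 one_pos
  have htorsK : ∀ (k : ℕ) (P : (W.baseChange K).toAffine.Point), ((2 ^ k : ℕ) : ℤ) • P = 0 → P = 0 := fun k P hP ↦
    EigenClassesFinite.forall_zsmul_two_pow_baseChange_eq_zero_of_hasSurjectiveModNGaloisRep_two W K h2 hs2 k P (by exact_mod_cast hP)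
  -- the level-`4` Kummer class of `2R`, with root `Q`
  have h4 : ((2 ^ 2 : ℕ) : ℤ) = 4 := by norm_num
  have hn0 : ((2 ^ 2 : ℕ) : ℤ) ≠ 0 := by positivity
  have hdiv4 : ∀ P : geomPoints (W.baseChange K), ∃ Q : geomPoints (W.baseChange K), ((2 ^ 2 : ℕ) : ℤ) • Q = P :=
    (W.baseChange K).zsmul_geomPoints_surjective_of_charZero hn0
  have hQ4 : ((2 ^ 2 : ℕ) : ℤ) • Q = toGeomPoints (W.baseChange K) ((2 : ℤ) • R) := by
    rw [h4, show (4 : ℤ) = 2 * 2 by norm_num, mul_smul, hQ, map_zsmul]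
  set δ := kummerMapTorsion (W.baseChange K) ((2 ^ 2 : ℕ) : ℤ) hdiv4 with hδ
  have hκ : δ ((2 : ℤ) • R) =
      kummerClassTorsion (W.baseChange K) ((2 ^ 2 : ℕ) : ℤ) Q (by rw [hQ4]; exact toGeomPoints_mem_fixedPoints _ _) := by
    rw [hδ, kummerMapTorsion_apply]
    exact kummerMapTorsionFun_eq (W.baseChange K) _ hdiv4 _ Q hQ4
  -- it dies on `Γ_{K(E[4])}`
  have hc : ∀ ρ ∈ torsionFixing (W.baseChange K) ((2 ^ 2 : ℕ) : ℤ),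
      h1Eval (W.baseChange K) ((2 ^ 2 : ℕ) : ℤ) (δ ((2 : ℤ) • R)) ρ = 0 := by
    intro ρ hρ'
    have hρ4 : ρ ∈ torsionFixing (W.baseChange K) (4 : ℤ) := by rw [← h4]; exact hρ'
    rw [hκ, ← ZeroMemClass.coe_eq_zero, GenusKolyTwistingPrime.coe_h1Eval_kummerClassTorsion (W.baseChange K) _ Q _ hρ', hQfix ρ hρ4,
      sub_self]
  -- and it is Selmer, hence `0` by (NPh_K) at level `L = 2`
  have h0 : δ ((2 : ℤ) • R) = 0 :=
    hNPh 2 (by norm_num) _ hc (fun w ↦ kummerMapTorsion_mem_selmerLocalKer (W.baseChange K) _ hdiv4 _ _)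
  -- so `2R = 4R″`, and `R = 2R″` since `E(K)[2] = 0`
  obtain ⟨R'', hR''⟩ : ∃ R'' : (W.baseChange K).toAffine.Point, ((2 ^ 2 : ℕ) : ℤ) • R'' = (2 : ℤ) • R := by
    have hmem : (2 : ℤ) • R ∈ (kummerMapTorsion (W.baseChange K) ((2 ^ 2 : ℕ) : ℤ) hdiv4).ker := by
      rw [AddMonoidHom.mem_ker, ← hδ, h0]
    rw [kummerMapTorsion_ker] at hmem
    obtain ⟨R'', hR''⟩ := hmem
    exact ⟨R'', by simpa using hR''⟩
  refine ⟨R'', ?_⟩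
  have h0' : (2 : ℤ) • ((2 : ℤ) • R'' - R) = 0 := by
    rw [zsmul_sub, smul_smul, show (2 : ℤ) * 2 = ((2 ^ 2 : ℕ) : ℤ) by norm_num, hR'', sub_self]
  exact sub_eq_zero.mp (htorsK 1 _ (by simpa using h0'))

/-! ## §2 K4Neg at a frame ⟸ WALL + U₂ + Q2 + PRINT + (NPh_K) -/

/-- **K4Neg AT A FRAME ⟸ WALL row 1 + U₂ + Q2 + PRINT + (NPh_K)** (binders of the route item `K4Neg` verbatim, then the route items by
name, then the all-places (NPh_K) of the frame).  ANY reduction at `2`, on or off the cut: §1 + `kFourNeg_conclusion_of_wallRows_U2_of_halvingBit`.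
CONDITIONAL on OPEN route items; BSD is NOT proved; K4Neg is NOT proved. [cite: McCallumLMS1991, §5 Thm. 5.4] [cite: LawsonWuthrich2016, §7.1] -/
theorem kFourNeg_conclusion_of_wallRows_U2_of_nonPhantom (hOrd : GoodOrdinaryRankZeroAtTwo) (hMult : MultiplicativeRankZeroAtTwo)
    (hSS : SupersingularRankZeroAtTwo) (hAdd : AdditiveRankZeroAtTwo) (hTw : MinimalTwinBSDTwo) (hQ2 : KolyvaginRelationAtTwo)
    (hGZ : GrossZagierAllLevels) (hGZK : MultPublishedInputsAtTwo) (hL : EntireLFunctionRat) (hMi : MilneAnyModel)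
    (W : WeierstrassCurve ℚ) [W.IsElliptic] [W.IsGloballyMinimal] [NeZero (W.conductorNorm ℤ)]
    (hcm : ¬ W.HasCM) (hr0 : W.analyticRank = 0) (hρ : ∀ n : ℕ, 0 < n → W.HasSurjectiveModNGaloisRep ((2 : ℤ) ^ n))
    (hT : Odd W.tamagawaProduct) (hneg : W.Δ < 0) (h4 : Nat.card (W.selmerGroup 2) = 4)
    (K : Type) [Field K] [NumberField K] (hIQ : IsImaginaryQuadratic K) (hodd : Odd (NumberField.discr K))
    (h3 : NumberField.discr K ≠ -3) (hHe : SatisfiesHeegnerHypothesis (W.conductorNorm ℤ) K)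
    (hsq1 : ¬ IsSquare ((NumberField.discr K : ℚ) * -|W.Δ|)) (hsq2 : ¬ IsSquare ((NumberField.discr K : ℚ) * (-(2 * |W.Δ|))))
    (ℓ₀ : ℕ) (hℓ₀ : ℓ₀.Prime) (hdK : NumberField.discr K = -(ℓ₀ : ℤ))
    (h2K : ((Ideal.span {(2 : ℤ)}).primesOver (𝓞 K)).ncard = 2)
    (Dt : ModularParametrizationData W (W.conductorNorm ℤ))
    (hopt : ∀ z ∈ Dt.L.lattice, ∃ w ∈ periodLattice Dt.f, z = (Dt.c : ℂ) * w) (hc : Odd Dt.c)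
    (β : ℤ) (ι : K →+* ℂ) (d₁ : KolyvaginHeegnerData Dt β ι 1) (hy : ¬ IsOfFinAddOrder d₁.derivedPoint)
    (M₀ : ℕ) (hdiv : ∃ Q : (W.baseChange (ringClassField K ι 1)).toAffine.Point, ((2 ^ M₀ : ℕ) : ℤ) • Q = d₁.derivedPoint)
    (hndiv : ¬ ∃ Q : (W.baseChange (ringClassField K ι 1)).toAffine.Point, ((2 ^ (M₀ + 1) : ℕ) : ℤ) • Q = d₁.derivedPoint)
    (hM₀ : 1 ≤ M₀)
    (Wd : WeierstrassCurve ℚ) [Wd.IsElliptic] [Wd.IsGloballyMinimal]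
    (hWd : ∃ C : VariableChange ℚ, C • W.quadraticTwist (NumberField.discr K : ℚ) = Wd)
    (hrd : Wd.analyticRank = 1) (hSel : Nat.card (Wd.selmerGroup 2) = 2) (hDEF : padicValNat 2 Wd.tamagawaProduct ≤ 1)
    (hNPh : ∀ (L : ℕ), 1 ≤ L → ∀ z : galH1Torsion (W.baseChange K) ((2 ^ L : ℕ) : ℤ),
      (∀ ρ' ∈ torsionFixing (W.baseChange K) ((2 ^ L : ℕ) : ℤ), h1Eval (W.baseChange K) ((2 ^ L : ℕ) : ℤ) z ρ' = 0) →
      (∀ w : HeightOneSpectrum (𝓞 K), z ∈ selmerLocalKer (W.baseChange K) (w.adicCompletion K) ((2 ^ L : ℕ) : ℤ)) → z = 0) :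
    ∃ (n : ℕ) (d : KolyvaginHeegnerData Dt β ι n), Squarefree n ∧
      (∀ ℓ ∈ n.primeFactors, Zhang2014.IsKolyvaginPrime (W.conductorNorm ℤ) W K 2 ℓ ∧ 2 ≤ Zhang2014.kolyvaginIndex W 2 ℓ ∧
        FrobEqFrobInfty W K 2 ℓ) ∧
      ¬ ∃ Q : (W.baseChange (ringClassField K ι n)).toAffine.Point, (2 : ℤ) • Q = d.derivedPoint :=
  kFourNeg_conclusion_of_wallRows_U2_of_halvingBit hOrd hMult hSS hAdd hTw hQ2 hGZ hGZK hL hMi W hcm hr0 hρ hT hneg h4 K hIQ hodd h3 hHe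
    hsq1 hsq2 ℓ₀ hℓ₀ hdK h2K Dt hopt hc β ι d₁ hy M₀ hdiv hndiv hM₀ Wd hWd hrd hSel hDEF (halvingBit_of_nonPhantom W K hIQ hρ hNPh)

/-! ## §3 K4Neg at a frame ⟸ WALL + U₂ + Q2 + PRINT, on the bit-TRUE curves (no level-4 phantom is a rational 2-Selmer class) -/

/-- **K4Neg AT A FRAME of a bit-TRUE curve ⟸ WALL row 1 + U₂ + Q2 + PRINT**: if every non-zero `x ∈ H¹(ℚ, E[2])` dying on `Γ_{ℚ(E[4])}` lies
outside `Sel₂(E/ℚ)` (a datum of rational `2`-descent on `E` alone), then (NPh_K) holds at the frame (LEAD g26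
`Lw2PhantomExclusion.nonPhantom_pow_iff_forall_notMem_selmerGroup_rat`, `2` split, `Δ < 0`) and §2 concludes.  CONDITIONAL on OPEN route
items; BSD is NOT proved; K4Neg is NOT proved. [cite: LawsonWuthrich2016, §3, §7.1, §8] [cite: McCallumLMS1991, §5 Thm. 5.4] -/
theorem kFourNeg_conclusion_of_wallRows_U2_of_forall_phantom_notMem_selmerGroup (hOrd : GoodOrdinaryRankZeroAtTwo)
    (hMult : MultiplicativeRankZeroAtTwo) (hSS : SupersingularRankZeroAtTwo) (hAdd : AdditiveRankZeroAtTwo) (hTw : MinimalTwinBSDTwo)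
    (hQ2 : KolyvaginRelationAtTwo) (hGZ : GrossZagierAllLevels) (hGZK : MultPublishedInputsAtTwo) (hL : EntireLFunctionRat)
    (hMi : MilneAnyModel)
    (W : WeierstrassCurve ℚ) [W.IsElliptic] [W.IsGloballyMinimal] [NeZero (W.conductorNorm ℤ)]
    (hcm : ¬ W.HasCM) (hr0 : W.analyticRank = 0) (hρ : ∀ n : ℕ, 0 < n → W.HasSurjectiveModNGaloisRep ((2 : ℤ) ^ n))
    (hT : Odd W.tamagawaProduct) (hneg : W.Δ < 0) (h4 : Nat.card (W.selmerGroup 2) = 4)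
    (K : Type) [Field K] [NumberField K] (hIQ : IsImaginaryQuadratic K) (hodd : Odd (NumberField.discr K))
    (h3 : NumberField.discr K ≠ -3) (hHe : SatisfiesHeegnerHypothesis (W.conductorNorm ℤ) K)
    (hsq1 : ¬ IsSquare ((NumberField.discr K : ℚ) * -|W.Δ|)) (hsq2 : ¬ IsSquare ((NumberField.discr K : ℚ) * (-(2 * |W.Δ|))))
    (ℓ₀ : ℕ) (hℓ₀ : ℓ₀.Prime) (hdK : NumberField.discr K = -(ℓ₀ : ℤ))
    (h2K : ((Ideal.span {(2 : ℤ)}).primesOver (𝓞 K)).ncard = 2)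
    (Dt : ModularParametrizationData W (W.conductorNorm ℤ))
    (hopt : ∀ z ∈ Dt.L.lattice, ∃ w ∈ periodLattice Dt.f, z = (Dt.c : ℂ) * w) (hc : Odd Dt.c)
    (β : ℤ) (ι : K →+* ℂ) (d₁ : KolyvaginHeegnerData Dt β ι 1) (hy : ¬ IsOfFinAddOrder d₁.derivedPoint)
    (M₀ : ℕ) (hdiv : ∃ Q : (W.baseChange (ringClassField K ι 1)).toAffine.Point, ((2 ^ M₀ : ℕ) : ℤ) • Q = d₁.derivedPoint)
    (hndiv : ¬ ∃ Q : (W.baseChange (ringClassField K ι 1)).toAffine.Point, ((2 ^ (M₀ + 1) : ℕ) : ℤ) • Q = d₁.derivedPoint)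
    (hM₀ : 1 ≤ M₀)
    (Wd : WeierstrassCurve ℚ) [Wd.IsElliptic] [Wd.IsGloballyMinimal]
    (hWd : ∃ C : VariableChange ℚ, C • W.quadraticTwist (NumberField.discr K : ℚ) = Wd)
    (hrd : Wd.analyticRank = 1) (hSel : Nat.card (Wd.selmerGroup 2) = 2) (hDEF : padicValNat 2 Wd.tamagawaProduct ≤ 1)
    (hbit : ∀ x : galH1Torsion W (2 : ℤ), x ≠ 0 → (∀ h ∈ torsionFixing W (4 : ℤ), h1Eval W (2 : ℤ) x h = 0) → x ∉ selmerGroup W (2 : ℤ)) :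
    ∃ (n : ℕ) (d : KolyvaginHeegnerData Dt β ι n), Squarefree n ∧
      (∀ ℓ ∈ n.primeFactors, Zhang2014.IsKolyvaginPrime (W.conductorNorm ℤ) W K 2 ℓ ∧ 2 ≤ Zhang2014.kolyvaginIndex W 2 ℓ ∧
        FrobEqFrobInfty W K 2 ℓ) ∧
      ¬ ∃ Q : (W.baseChange (ringClassField K ι n)).toAffine.Point, (2 : ℤ) • Q = d.derivedPoint := by
  have hN : W.conductorNorm ℤ ≠ 0 := NeZero.ne _
  have hNPh := (Lw2PhantomExclusion.nonPhantom_pow_iff_forall_notMem_selmerGroup_rat W hρ hneg hIQ hodd hsq1 hsq2 hN hHe h2K).mpr hbit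
  exact kFourNeg_conclusion_of_wallRows_U2_of_nonPhantom hOrd hMult hSS hAdd hTw hQ2 hGZ hGZK hL hMi W hcm hr0 hρ hT hneg h4 K hIQ hodd
    h3 hHe hsq1 hsq2 ℓ₀ hℓ₀ hdK h2K Dt hopt hc β ι d₁ hy M₀ hdiv hndiv hM₀ Wd hWd hrd hSel hDEF
    (fun L hL1 z hz hw ↦ hNPh L hL1 z hz (fun w _ ↦ hw w))

/-! ## §4 K4Neg at a frame ⟸ WALL + U₂ + Q2 + PRINT + the (α) Galois datum -/

/-- **K4Neg AT A FRAME ⟸ WALL row 1 + U₂ + Q2 + PRINT + the (α) GALOIS DATUM** (binders of `K4Neg` verbatim; then the items; then: a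
non-zero `ξ ∈ H¹(ℚ, E[2])` dying on `Γ_{ℚ(E[4])}`, the place `v` of `ℓ₀`, a prime `𝔓₀ ∣ v` of `\bar ℤ` and an arithmetic Frobenius `F` at `𝔓₀`
with `F·F ∈ Γ_{ℚ(E[2])}` and `[ξ, F·F] ≠ 0` — exactly the output of gk2-p3's supply `exists_alive_primeFrame_of_phantom_selmer`).  Proof:
`E(ℚ)` is finite (GZK at `r_an = 0`, `mordellWeilRank_eq_zero_iff_finite`), so gk2-p3's `hDesc_of_phantom_alive` gives the descent bit `hDesc`
of g28's `kFourNeg_conclusion_of_bsdp_pair_of_heegnerDescent`; `BSD₂(E)` from the WALL rows, `BSD₂(Wd)` from U₂.  CONDITIONAL on OPEN route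
items; BSD is NOT proved; K4Neg is NOT proved. [cite: LawsonWuthrich2016, §3, §7.1] [cite: McCallumLMS1991, §5 Thm. 5.4]
[cite: GrossLMS1991, §9 Prop. 9.6] -/
theorem kFourNeg_conclusion_of_wallRows_U2_of_alive (hOrd : GoodOrdinaryRankZeroAtTwo) (hMult : MultiplicativeRankZeroAtTwo)
    (hSS : SupersingularRankZeroAtTwo) (hAdd : AdditiveRankZeroAtTwo) (hTw : MinimalTwinBSDTwo) (hQ2 : KolyvaginRelationAtTwo)
    (hGZ : GrossZagierAllLevels) (hGZK : MultPublishedInputsAtTwo) (hL : EntireLFunctionRat) (hMi : MilneAnyModel)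
    (W : WeierstrassCurve ℚ) [W.IsElliptic] [W.IsGloballyMinimal] [NeZero (W.conductorNorm ℤ)]
    (hcm : ¬ W.HasCM) (hr0 : W.analyticRank = 0) (hρ : ∀ n : ℕ, 0 < n → W.HasSurjectiveModNGaloisRep ((2 : ℤ) ^ n))
    (hT : Odd W.tamagawaProduct) (hneg : W.Δ < 0) (_h4 : Nat.card (W.selmerGroup 2) = 4)
    (K : Type) [Field K] [NumberField K] (hIQ : IsImaginaryQuadratic K) (hodd : Odd (NumberField.discr K))
    (h3 : NumberField.discr K ≠ -3) (hHe : SatisfiesHeegnerHypothesis (W.conductorNorm ℤ) K)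
    (hsq1 : ¬ IsSquare ((NumberField.discr K : ℚ) * -|W.Δ|)) (hsq2 : ¬ IsSquare ((NumberField.discr K : ℚ) * (-(2 * |W.Δ|))))
    (ℓ₀ : ℕ) (hℓ₀ : ℓ₀.Prime) (hdK : NumberField.discr K = -(ℓ₀ : ℤ))
    (_h2K : ((Ideal.span {(2 : ℤ)}).primesOver (𝓞 K)).ncard = 2)
    (Dt : ModularParametrizationData W (W.conductorNorm ℤ))
    (_hopt : ∀ z ∈ Dt.L.lattice, ∃ w ∈ periodLattice Dt.f, z = (Dt.c : ℂ) * w) (hc : Odd Dt.c)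
    (β : ℤ) (ι : K →+* ℂ) (d₁ : KolyvaginHeegnerData Dt β ι 1) (hy : ¬ IsOfFinAddOrder d₁.derivedPoint)
    (M₀ : ℕ) (hdiv : ∃ Q : (W.baseChange (ringClassField K ι 1)).toAffine.Point, ((2 ^ M₀ : ℕ) : ℤ) • Q = d₁.derivedPoint)
    (hndiv : ¬ ∃ Q : (W.baseChange (ringClassField K ι 1)).toAffine.Point, ((2 ^ (M₀ + 1) : ℕ) : ℤ) • Q = d₁.derivedPoint)
    (hM₀ : 1 ≤ M₀)
    (Wd : WeierstrassCurve ℚ) [Wd.IsElliptic] [Wd.IsGloballyMinimal]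
    (hWd : ∃ C : VariableChange ℚ, C • W.quadraticTwist (NumberField.discr K : ℚ) = Wd)
    (hrd : Wd.analyticRank = 1) (hSel : Nat.card (Wd.selmerGroup 2) = 2) (hDEF : padicValNat 2 Wd.tamagawaProduct ≤ 1)
    {ξ : galH1Torsion W (2 : ℤ)} (hξ0 : ξ ≠ 0) (hξ4 : ∀ h ∈ torsionFixing W (4 : ℤ), h1Eval W (2 : ℤ) ξ h = 0)
    {v : HeightOneSpectrum (𝓞 ℚ)} (hv : (primesEquiv v : ℕ) = ℓ₀) {𝔓₀ : Ideal (absIntegers (𝓞 ℚ) ℚ)} (h𝔓₀ : 𝔓₀ ∈ v.primesAbove)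
    {F : absoluteGaloisGroup ℚ} (hF : IsArithFrobAt (𝓞 ℚ) F 𝔓₀) (hF2 : F * F ∈ torsionFixing W (2 : ℤ))
    (hval : h1Eval W (2 : ℤ) ξ (F * F) ≠ 0) :
    ∃ (n : ℕ) (d : KolyvaginHeegnerData Dt β ι n), Squarefree n ∧
      (∀ ℓ ∈ n.primeFactors, Zhang2014.IsKolyvaginPrime (W.conductorNorm ℤ) W K 2 ℓ ∧ 2 ≤ Zhang2014.kolyvaginIndex W 2 ℓ ∧
        FrobEqFrobInfty W K 2 ℓ) ∧
      ¬ ∃ Q : (W.baseChange (ringClassField K ι n)).toAffine.Point, (2 : ℤ) • Q = d.derivedPoint := by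
  haveI : Fact ℓ₀.Prime := ⟨hℓ₀⟩
  have hBW : BSDp W 2 := Census.bsdp_rankZero_of_wallRows hOrd hMult hSS hAdd W hcm hr0
  have hd : (NumberField.discr K : ℚ) ≠ 0 := Int.cast_ne_zero.mpr (NumberField.discr_ne_zero K)
  have hcmd : ¬ Wd.HasCM := by
    obtain ⟨C, hC⟩ := hWd
    haveI := W.isElliptic_quadraticTwist hd
    rw [← hC]
    exact not_hasCM_variableChange _ C (not_hasCM_quadraticTwist W hd hcm)
  have hBd : BSDp Wd 2 := hTw Wd hcmd hrd hSel
  -- the `K`-rational Heegner point under `P(1)`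
  obtain ⟨Ph, -, hPh⟩ := AdditiveKoly.exists_isHeegnerPoint_map_eq_derivedPoint_one (W := W) (K := K) (Dt := Dt) (β := β) (ι := ι) hIQ hHe d₁
  -- `E(ℚ)` is torsion (rank `0` through GZK), read in `E(ℚ̄)`
  have hrk0 : W.mordellWeilRank = 0 := by rw [(hGZK W (by rw [hr0]; exact zero_le_one)).1, hr0]
  haveI : Finite W.toAffine.Point := W.mordellWeilRank_eq_zero_iff_finite.mp hrk0
  have htor : ∀ s : W.toAffine.Point, IsOfFinAddOrder (WeierstrassCurve.toGeomPoints W s) :=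
    isOfFinAddOrder_toGeomPoints_of_finite W
  -- the good ramified prime `ℓ₀ ∣ d_K`
  have hℓK : (ℓ₀ : ℤ) ∣ NumberField.discr K := ⟨-1, by rw [hdK]; ring⟩
  obtain ⟨-, -, hℓΔ⟩ := GenusKolyTwin.prime_discr_facts W hIQ hodd hHe hℓ₀ hdK
  exact kFourNeg_conclusion_of_bsdp_pair_of_heegnerDescent hQ2 hGZ hGZK hL hMi W hcm hr0 hρ hT hneg K hIQ hodd h3 hHe hsq1 hsq2 Dt hc β ι d₁ hy
    Ph hPh M₀ hdiv hndiv hM₀ Wd hWd hrd hSel hDEF hBW hBd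
    (fun M b Q hfix hQ ↦ PhantomDescentBit.hDesc_of_phantom_alive W hρ hIQ hodd hsq1 hsq2 hℓK hℓΔ hξ0 hξ4 hv h𝔓₀ hF hF2 hval
      (PhantomDescentBit.forall_fixed_odd_torsion_of_rank_zero W hρ hIQ htor) Ph (M := M) (L := M + 2) (by omega) (by omega) b Q hfix hQ)

/-! ## §5 K4Neg at every prime Heegner frame with `4 ∤ a_{ℓ₀}(E)` ⟸ WALL + U₂ + Q2 + PRINT -/

/-- ★ **K4Neg AT EVERY FRAME WITH `4 ∤ a_{ℓ₀}(E)` ⟸ WALL row 1 + U₂ + Q2 + PRINT** — binders of the route item `K4Neg` VERBATIM, then the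
route items BY NAME, then the single arithmetic bit `¬ 4 ∣ W.frobeniusTrace ℓ₀`.  Proof: the Lawson–Wuthrich class `ξ` exists (`ρ_{E,4}` onto,
`GenusKolyTwistingPrime.exists_ne_zero_forall_torsionFixing_four_h1Eval_eq_zero`); at the place of `ℓ₀` take a prime of `\bar ℤ` and an
arithmetic Frobenius `F` (`exists_isArithFrobAt_of_mem_primesAbove_holds`); gk2-p4's prime-frame trace bit gives `F·F ∈ Γ_{ℚ(E[2])}` and
`[ξ, F·F] = 0 ↔ 4 ∣ a_{ℓ₀}`; so `4 ∤ a_{ℓ₀}` is the (α) datum and §4 concludes.  This is the by-name closer of the restated item «K4Neg ∧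
`¬ 4 ∣ a_{ℓ₀}`»; the frames with `4 ∣ a_{ℓ₀}` (the (β)-frames) are NOT covered.  CONDITIONAL on OPEN route items; BSD is NOT proved; K4Neg is
NOT proved. [cite: LawsonWuthrich2016, §3, §7.1] [cite: McCallumLMS1991, §5 Thm. 5.4] [cite: SilvermanAEC2009, Thm. V.2.3.1] -/
theorem kFourNeg_conclusion_of_wallRows_U2_of_not_four_dvd_frobeniusTrace (hOrd : GoodOrdinaryRankZeroAtTwo)
    (hMult : MultiplicativeRankZeroAtTwo) (hSS : SupersingularRankZeroAtTwo) (hAdd : AdditiveRankZeroAtTwo) (hTw : MinimalTwinBSDTwo)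
    (hQ2 : KolyvaginRelationAtTwo) (hGZ : GrossZagierAllLevels) (hGZK : MultPublishedInputsAtTwo) (hL : EntireLFunctionRat)
    (hMi : MilneAnyModel)
    (W : WeierstrassCurve ℚ) [W.IsElliptic] [W.IsGloballyMinimal] [NeZero (W.conductorNorm ℤ)]
    (hcm : ¬ W.HasCM) (hr0 : W.analyticRank = 0) (hρ : ∀ n : ℕ, 0 < n → W.HasSurjectiveModNGaloisRep ((2 : ℤ) ^ n))
    (hT : Odd W.tamagawaProduct) (hneg : W.Δ < 0) (h4 : Nat.card (W.selmerGroup 2) = 4)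
    (K : Type) [Field K] [NumberField K] (hIQ : IsImaginaryQuadratic K) (hodd : Odd (NumberField.discr K))
    (h3 : NumberField.discr K ≠ -3) (hHe : SatisfiesHeegnerHypothesis (W.conductorNorm ℤ) K)
    (hsq1 : ¬ IsSquare ((NumberField.discr K : ℚ) * -|W.Δ|)) (hsq2 : ¬ IsSquare ((NumberField.discr K : ℚ) * (-(2 * |W.Δ|))))
    (ℓ₀ : ℕ) (hℓ₀ : ℓ₀.Prime) (hdK : NumberField.discr K = -(ℓ₀ : ℤ))
    (h2K : ((Ideal.span {(2 : ℤ)}).primesOver (𝓞 K)).ncard = 2)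
    (Dt : ModularParametrizationData W (W.conductorNorm ℤ))
    (hopt : ∀ z ∈ Dt.L.lattice, ∃ w ∈ periodLattice Dt.f, z = (Dt.c : ℂ) * w) (hc : Odd Dt.c)
    (β : ℤ) (ι : K →+* ℂ) (d₁ : KolyvaginHeegnerData Dt β ι 1) (hy : ¬ IsOfFinAddOrder d₁.derivedPoint)
    (M₀ : ℕ) (hdiv : ∃ Q : (W.baseChange (ringClassField K ι 1)).toAffine.Point, ((2 ^ M₀ : ℕ) : ℤ) • Q = d₁.derivedPoint)
    (hndiv : ¬ ∃ Q : (W.baseChange (ringClassField K ι 1)).toAffine.Point, ((2 ^ (M₀ + 1) : ℕ) : ℤ) • Q = d₁.derivedPoint)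
    (hM₀ : 1 ≤ M₀)
    (Wd : WeierstrassCurve ℚ) [Wd.IsElliptic] [Wd.IsGloballyMinimal]
    (hWd : ∃ C : VariableChange ℚ, C • W.quadraticTwist (NumberField.discr K : ℚ) = Wd)
    (hrd : Wd.analyticRank = 1) (hSel : Nat.card (Wd.selmerGroup 2) = 2) (hDEF : padicValNat 2 Wd.tamagawaProduct ≤ 1)
    (hα : ¬ (4 : ℤ) ∣ W.frobeniusTrace ℓ₀) :
    ∃ (n : ℕ) (d : KolyvaginHeegnerData Dt β ι n), Squarefree n ∧
      (∀ ℓ ∈ n.primeFactors, Zhang2014.IsKolyvaginPrime (W.conductorNorm ℤ) W K 2 ℓ ∧ 2 ≤ Zhang2014.kolyvaginIndex W 2 ℓ ∧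
        FrobEqFrobInfty W K 2 ℓ) ∧
      ¬ ∃ Q : (W.baseChange (ringClassField K ι n)).toAffine.Point, (2 : ℤ) • Q = d.derivedPoint := by
  haveI : Fact ℓ₀.Prime := ⟨hℓ₀⟩
  have hs2 : W.HasSurjectiveModNGaloisRep 2 := by simpa using hρ 1 one_pos
  have hs4 : W.HasSurjectiveModNGaloisRep 4 := by have h := hρ 2 two_pos; norm_num at h; exact h
  -- the Lawson–Wuthrich class
  obtain ⟨ξ, hξ0, hξ4⟩ := GenusKolyTwistingPrime.exists_ne_zero_forall_torsionFixing_four_h1Eval_eq_zero W hs4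
  -- the place of `ℓ₀`, a prime of `\bar ℤ` above it, an arithmetic Frobenius there
  set v : HeightOneSpectrum (𝓞 ℚ) := primesEquiv.symm ⟨ℓ₀, hℓ₀⟩ with hvdef
  have hℓv : (ℓ₀ : 𝓞 ℚ) ∈ v.asIdeal := (VisiblePairAtTwo.natCast_prime_mem_iff_eq hℓ₀ v).mpr rfl
  have hv : (primesEquiv v : ℕ) = ℓ₀ := GenusKolyTwistingPrime.primesEquiv_eq hℓ₀ hℓv
  have h𝔓₀ := adicCompletionPrime_mem_primesAbove ℚ v
  obtain ⟨F, hF⟩ := HeightOneSpectrum.exists_isArithFrobAt_of_mem_primesAbove_holds h𝔓₀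
  -- gk2-p4's prime-frame trace bit: `F·F ∈ Γ_{ℚ(E[2])}` and `[ξ, F·F] = 0 ↔ 4 ∣ a_{ℓ₀}`
  obtain ⟨hF2, hiff⟩ := PhantomDescentBit.TraceBit.h1Eval_frob_mul_frob_eq_zero_iff_four_dvd_of_prime_frame W hs2 hs4 hneg hξ0 hξ4 hIQ hodd
    hHe hdK hℓv h𝔓₀ hF
  have hval : h1Eval W (2 : ℤ) ξ (F * F) ≠ 0 := fun h ↦ hα (hiff.mp h)
  exact kFourNeg_conclusion_of_wallRows_U2_of_alive hOrd hMult hSS hAdd hTw hQ2 hGZ hGZK hL hMi W hcm hr0 hρ hT hneg h4 K hIQ hodd h3 hHe hsq1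
    hsq2 ℓ₀ hℓ₀ hdK h2K Dt hopt hc β ι d₁ hy M₀ hdiv hndiv hM₀ Wd hWd hrd hSel hDEF hξ0 hξ4 hv h𝔓₀ hF hF2 hval

end Summit.BirchSwinnertonDyer.BirchSwinnertonDyer.Theorems.GenusExact.PlusDescent

end
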